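import Summits.BirchSwinnertonDyer.BirchSwinnertonDyer.Theorems.KolyvaginRoadThreeZhangInductionOfKolyvaginSystemFinite
import Summits.BirchSwinnertonDyer.BirchSwinnertonDyer.Theorems.KolyvaginRoadThreeMethod2LevelSystems
import Summits.BirchSwinnertonDyer.BirchSwinnertonDyer.Theorems.KolyvaginRoadThreeMethod2ParityRank
import Summits.BirchSwinnertonDyer.BirchSwinnertonDyer.Theorems.KolyvaginRoadThreeMethod2Eigen
import HarnessLib

/-!
# KOLY method line, crux stmt-BirchSwinnertonDyer-19574 `ZhangSharpFrameAtThreeHL`: the SPINE of the proposed stub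
# S2-ENGINE — W. Zhang's induction above the bottom from a `LevelKolyvaginSystem`, (A1) and odd Selmer rank `≥ 3`,
# modulo the engine's LEVEL-INDEPENDENT inputs (cell `bsd-stepL`, seat `bsd-stepL-zhang3-p1` g8; `--supports 19574`,
# helper; skeleton proposal v3 `HOME/zhang3/skel/Lines-method3-19574.lean`)

HONEST FRAMING. Theorems only; 0 definitions, 0 named facts, 0 `sorry`; CONDITIONAL on every binder; closes nothing
(T7). PARTITION: O2@3 (B10) × A1 × crux 19574 × stub S2 (proposed cut S2-KS + S2-ENGINE) — types-the-object-of.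

WHAT. The proposed stub S2-ENGINE `stub_inductionOfLevelSystemsAtThree` of the v3 re-line says: at an HL A1 frame, a
`Method2.LevelKolyvaginSystem` (p496874) + stub A's (A1) + `dim Sel₃(E/K)` odd and `≥ 3` ⟹ a non-zero Kolyvagin class
of the frame. This file proves it MODULO the level-independent inputs of the engine-of-KS, all read in ENGINE currency
over an arbitrary place-indexed apparatus `(P, Hv, loc, b, E, L, pl, plQ, Fv, Tv)`: the membership dictionaries
`hSel` ∕ `hSelRel` for `SelQ` ∕ `SelRelQ`, `hB` for `baseLocusQ`, the Kolyvagin-system readings `hcE` ∕ `hcL` ∕ `hcT`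
∕ `hfs` of the system's classes, and (REC), (Cheb) ×2, (Supply), (Perf) ∕ (Line) ∕ (Iso), `hpl`, `hLF` — exactly the
list the S2-ENGINE work package must discharge in the model (memo `HOME/zhang3/S2-RELINE-19574.md` §2). New here:
* §1 `ZhangInductionOnPos.exists_ne_zero_of_zhangInduction_on_pos_oddStart` — the engine with parity CARRIED (koly3a's
  odd-start form) AND the triangulation (A3) ∕ base case (A5) asked only at NON-EMPTY levels (koly3b's observation),
  for starting levels that are non-empty or of rank `≠ 1`;
* §2 `ZhangTriangulation.exists_ne_zero_of_zhangInduction_on_of_kolyvaginSystem_finite_oddStart` — the same with (A3)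
  DERIVED from Kolyvagin-system axioms at non-empty levels (`triangulation_finite`, p493507: no finiteness posit);
* §3 `Method2.kolSupp_finsetProd`, `Method2.LevelKolyvaginSystem.exists_kolyvaginClass_ne_zero` — a non-zero bottom
  class `κ m ∅` of a level system IS a crux witness (realisation + `KolSupp` of a square-free product of Kolyvagin
  primes);
* §4 `Method2.inductionOfLevelSystems_of_engineInputs` — S2-ENGINE's conclusion from a `LevelKolyvaginSystem`, (A1),
  the parity and `3 ≤ dim`, modulo the engine-currency inputs: `Good := GoodLevel`, `Sel := SelQ`, `SelRel := SelRelQ`,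
  `B := baseLocusQ κ`, `m₁ := ∅`, (A2) = `transport`, (A5) = `baseCase`, (A4) = `relaxation_le`, oddness at `∅` from
  `dim Sel₃(E/K)` by `finrank_selmer_eq_finrank_selQ_add`, the rank-`≠ 1` side condition from `3 ≤ dim`.

References: [cite: WZhang2014, §9 proof of Thm. 9.1, Lemma 8.4, §8.1, Thm. 9.2] [cite: McCallumLMS1991, Prop. 3.1,
Lemma 5.3] [cite: GrossLMS1991, §3 (square-free products of Kolyvagin primes)].
-/

noncomputable section

open scoped Classical

/-! ## §1 The engine, odd-start form, (A3) and (A5) only above the bottom -/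

namespace Summit.BirchSwinnertonDyer.Rank1Residual.X11b.Three.Koly.ZhangInductionOnPos

open Module

variable {F : Type*} [Field F] {H : Type*} [AddCommGroup H] [Module F H]
  {Q : Type*} [DecidableEq Q] {M : Type*}

/-- A submodule of positive dimension has a non-zero element. [folklore] -/
private theorem exists_mem_ne_zero_of_finrank_pos'' {S : Submodule F H} (h : 0 < finrank F S) :
    ∃ c ∈ S, c ≠ 0 := by
  by_contra hc
  push Not at hc
  have hbot : S = ⊥ := (Submodule.eq_bot_iff S).mpr hc
  rw [hbot, finrank_bot] at h
  exact lt_irrefl 0 h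

omit [DecidableEq Q] in
/-- The total rank does not depend on which eigenspace is listed first. [folklore] -/
private theorem rank_symm'' (Sel : Finset Q → Bool → Submodule F H) (n : Finset Q) (μ : Bool) :
    finrank F (Sel n μ) + finrank F (Sel n (!μ)) = finrank F (Sel n true) + finrank F (Sel n false) := by
  cases μ
  · rw [Bool.not_false, add_comm]
  · rw [Bool.not_true]

/-- **Zhang's induction on good levels, ODD START, triangulation and base case only at NON-EMPTY levels.** Data and
(A1), (A2), (A4) as in `exists_ne_zero_of_zhangInduction_on_pos`; (A3) and (A5) carry the binder `n.Nonempty`; no (A6):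
the oddness of the total rank is a hypothesis on the starting level and is CARRIED along the two rank-lowering steps
(koly3a `ZhangInduction.exists_ne_zero_of_zhangInduction_on_oddStart`). Conclusion at every good even level of odd total
rank which is non-empty OR of rank `≠ 1` (at `∅` of rank one the base case would be needed at the bottom). Proof =
Zhang's §9: rank one ⟹ (A5) (the level is non-empty); rank `≥ 3` ⟹ lower twice inside the larger eigenspace, recurse at
`n ∪ {q₁, q₂}` (non-empty, odd rank), transport by (A2) unless `q₂` is a base point, excluded by (A3) at the non-empty
level + (A4). [cite: WZhang2014, §9 proof of Thm. 9.1, Lemma 8.4, Prop. 5.4, Thm. 4.3, Thm. 7.2, Thm. 9.2] -/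
theorem exists_ne_zero_of_zhangInduction_on_pos_oddStart (Good : Finset Q → Prop)
    (Sel : Finset Q → Bool → Submodule F H) (SelRel : Finset Q → Set Q → Bool → Submodule F H)
    (B : Finset Q → Set Q) (κ : M → Finset Q → H) (m₁ : M)
    (hA1 : ∀ (n : Finset Q) (μ : Bool) (c : H), Good n → c ∈ Sel n μ → c ≠ 0 →
      ∃ q, q ∉ n ∧ Good (insert q n) ∧ c ∉ Sel (insert q n) μ ∧ Sel (insert q n) μ ≤ Sel n μ ∧
        finrank F (Sel (insert q n) μ) + 1 = finrank F (Sel n μ) ∧ Sel (insert q n) (!μ) = Sel n (!μ))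
    (hA2 : ∀ (n : Finset Q) (q₁ q₂ : Q), Good n → Good (insert q₁ n) → Good (insert q₂ (insert q₁ n)) →
      q₁ ∉ n → q₂ ∉ insert q₁ n → q₂ ∉ B (insert q₂ (insert q₁ n)) → ∃ m, κ m n ≠ 0)
    (hA3 : ∀ (n : Finset Q), Good n → n.Nonempty → Even n.card → (∃ m, κ m n ≠ 0) →
      ∃ (s : Bool) (d : ℕ), finrank F (Sel n s) = d + 1 ∧ Sel n s = SelRel n (B n) s ∧
        FiniteDimensional F (SelRel n (B n) (!s)) ∧ finrank F (SelRel n (B n) (!s)) ≤ d)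
    (hA4 : ∀ (n : Finset Q) (q : Q) (S : Set Q) (s : Bool), Good n → Good (insert q n) → q ∉ n → q ∈ S →
      Sel n s ≤ SelRel (insert q n) S s)
    (hA5 : ∀ (n : Finset Q), Good n → n.Nonempty → Even n.card →
      finrank F (Sel n true) + finrank F (Sel n false) = 1 → κ m₁ n ≠ 0) :
    ∀ (n : Finset Q), Good n → Even n.card → Odd (finrank F (Sel n true) + finrank F (Sel n false)) →
      (n.Nonempty ∨ finrank F (Sel n true) + finrank F (Sel n false) ≠ 1) → ∃ m, κ m n ≠ 0 := by
  suffices hmain : ∀ (k : ℕ) (n : Finset Q), Good n → finrank F (Sel n true) + finrank F (Sel n false) = k →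
      Even n.card → Odd k → (n.Nonempty ∨ k ≠ 1) → ∃ m, κ m n ≠ 0 from
    fun n hg hn hodd hne ↦ hmain _ n hg rfl hn hodd hne
  intro k
  induction k using Nat.strong_induction_on with
  | _ k ih =>
    intro n hg hk hn hodd hne
    by_cases h1 : finrank F (Sel n true) + finrank F (Sel n false) = 1
    · rcases hne with hne | hne
      · exact ⟨m₁, hA5 n hg hne hn h1⟩
      · exact absurd (hk ▸ h1) hne
    have h3 : 3 ≤ finrank F (Sel n true) + finrank F (Sel n false) := by
      obtain ⟨t, ht⟩ := hodd
      omega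
    obtain ⟨μ, hμ⟩ : ∃ μ : Bool, finrank F (Sel n (!μ)) < finrank F (Sel n μ) := by
      by_cases hlt : finrank F (Sel n false) < finrank F (Sel n true)
      · exact ⟨true, by rw [Bool.not_true]; exact hlt⟩
      · refine ⟨false, ?_⟩
        have hne' : finrank F (Sel n true) ≠ finrank F (Sel n false) := by
          intro heq
          obtain ⟨t, ht⟩ := hodd
          omega
        rw [Bool.not_false]
        omega
    have hsum := rank_symm'' Sel n μ
    have hμ2 : 2 ≤ finrank F (Sel n μ) := by omega
    -- two rank-lowering steps inside the μ-eigenspace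
    obtain ⟨c₁, hc₁, hc₁0⟩ := exists_mem_ne_zero_of_finrank_pos'' (S := Sel n μ) (by omega)
    obtain ⟨q₁, hq₁n, hg₁, -, -, hrk₁, hneg₁⟩ := hA1 n μ c₁ hg hc₁ hc₁0
    obtain ⟨c₂, hc₂, hc₂0⟩ := exists_mem_ne_zero_of_finrank_pos'' (S := Sel (insert q₁ n) μ) (by omega)
    obtain ⟨q₂, hq₂n, hg₂, hc₂out, hle₂, hrk₂, hneg₂⟩ := hA1 (insert q₁ n) μ c₂ hg₁ hc₂ hc₂0
    set n₁ := insert q₁ n with hn₁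
    set n₂ := insert q₂ n₁ with hn₂
    have hne₂ : n₂.Nonempty := Finset.insert_nonempty q₂ n₁
    have hcard : n₂.card = n.card + 2 := by
      rw [hn₂, Finset.card_insert_of_notMem hq₂n, hn₁, Finset.card_insert_of_notMem hq₁n]
    have hn₂even : Even n₂.card := by
      obtain ⟨t, ht⟩ := hn
      exact ⟨t + 1, by rw [hcard]; omega⟩
    have hsum₂ := rank_symm'' Sel n₂ μ
    have hrank₂ : finrank F (Sel n₂ true) + finrank F (Sel n₂ false) + 2 = k := by
      rw [← hsum₂, hneg₂, hneg₁, ← hk, ← hsum]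
      omega
    have hodd₂ : Odd (finrank F (Sel n₂ true) + finrank F (Sel n₂ false)) := by
      obtain ⟨t, ht⟩ := hodd
      exact ⟨t - 1, by omega⟩
    obtain ⟨m', hm'⟩ := ih _ (by omega) n₂ hg₂ rfl hn₂even hodd₂ (Or.inl hne₂)
    -- transport down by (A2) unless q₂ is a base point of the level-n₂ system
    refine hA2 n q₁ q₂ hg hg₁ hg₂ hq₁n hq₂n fun hq₂B ↦ ?_
    obtain ⟨s, d, hs1, hs2, hsfin, hs3⟩ := hA3 n₂ hg₂ hne₂ hn₂even ⟨m', hm'⟩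
    by_cases hsμ : s = μ
    · subst hsμ
      have hincl : Sel n₁ s ≤ SelRel n₂ (B n₂) s := hA4 n₁ q₂ (B n₂) s hg₁ hg₂ hq₂n hq₂B
      exact hc₂out (hs2 ▸ hincl hc₂)
    · have hs : s = !μ := by
        cases s <;> cases μ <;> first | rfl | exact (hsμ rfl).elim
      subst hs
      have hincl : Sel n₁ μ ≤ SelRel n₂ (B n₂) μ := hA4 n₁ q₂ (B n₂) μ hg₁ hg₂ hq₂n hq₂B
      haveI : FiniteDimensional F (SelRel n₂ (B n₂) μ) := by rw [Bool.not_not] at hsfin; exact hsfin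
      have hle : finrank F (Sel n₁ μ) ≤ finrank F (SelRel n₂ (B n₂) μ) := Submodule.finrank_mono hincl
      have hs3' : finrank F (SelRel n₂ (B n₂) μ) ≤ d := by rw [Bool.not_not] at hs3; exact hs3
      rw [hneg₂, hneg₁] at hs1
      omega

end Summit.BirchSwinnertonDyer.Rank1Residual.X11b.Three.Koly.ZhangInductionOnPos

/-! ## §2 The engine-of-KS, odd-start form, Kolyvagin-system axioms only above the bottom -/

namespace Summit.BirchSwinnertonDyer.Rank1Residual.X11b.Three.Koly.ZhangTriangulation

open Module Finset

variable {F : Type*} [Field F] {H : Type*} [AddCommGroup H] [Module F H]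
variable {P : Type*} {Hv : P → Type*} [∀ v, AddCommGroup (Hv v)] [∀ v, Module F (Hv v)]
variable {ι : Type*} {Q : Type*}

/-- **W. Zhang's induction, ODD START, with (A3) DERIVED from Kolyvagin-system axioms AT NON-EMPTY LEVELS and no
finiteness posit.** Binders = those of `exists_ne_zero_of_zhangInduction_on_of_kolyvaginSystem_finite_pos` MINUS
`hA6`, with `hA5` at non-empty levels; conclusion = a non-zero class at every good even level of ODD total rank that is
non-empty or of rank `≠ 1` — the form the S2 re-line consumes (start `∅`, rank `≥ 3`). Proof: §1 with (A3) supplied by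
`triangulation_finite`. CONDITIONAL on every binder; uniform in `F`. [cite: WZhang2014, Thm. 9.1, Thm. 9.2, Lemma 8.4,
§8.1] [cite: McCallumLMS1991, Prop. 3.1, Lemma 5.3] -/
theorem exists_ne_zero_of_zhangInduction_on_of_kolyvaginSystem_finite_oddStart [DecidableEq ι] [DecidableEq P]
    [DecidableEq Q] (Good : Finset Q → Prop)
    (Sel : Finset Q → Bool → Submodule F H) (SelRel : Finset Q → Set Q → Bool → Submodule F H)
    (B : Finset Q → Set Q) (κ : Finset ι → Finset Q → H) (m₁ : Finset ι)
    (E : Bool → Submodule F H) (loc : (v : P) → H →ₗ[F] Hv v) (b : (v : P) → Hv v →ₗ[F] Hv v →ₗ[F] F)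
    (L : Finset Q → (v : P) → Submodule F (Hv v)) (pl : ι → P) (plQ : Q → P)
    (Fv Tv : (ℓ : ι) → Submodule F (Hv (pl ℓ))) (ε₀ : Finset Q → Bool)
    (hSel : ∀ n, Good n → ∀ (s : Bool) (x : H), x ∈ Sel n s ↔ x ∈ E s ∧ ∀ v, loc v x ∈ L n v)
    (hSelRel : ∀ n, Good n → ∀ (s : Bool) (x : H),
      x ∈ SelRel n (B n) s ↔ x ∈ E s ∧ ∀ v, v ∉ plQ '' B n → loc v x ∈ L n v)
    (hB : ∀ n, ∀ q ∈ B n, ∀ m, loc (plQ q) (κ m n) = 0)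
    (hpl : Function.Injective pl)
    (hLF : ∀ n ℓ, L n (pl ℓ) = Fv ℓ)
    (hisoL : ∀ n (v : P), ∀ x ∈ L n v, ∀ y ∈ L n v, b v x y = 0)
    (hisoT : ∀ (ℓ : ι), ∀ x ∈ Tv ℓ, ∀ y ∈ Tv ℓ, b (pl ℓ) x y = 0)
    (hperf : ∀ (ℓ : ι) (s : Bool), ∀ x ∈ E s, ∀ y ∈ E s, loc (pl ℓ) x ∈ Fv ℓ → loc (pl ℓ) x ≠ 0 →
      loc (pl ℓ) y ∈ Tv ℓ → loc (pl ℓ) y ≠ 0 → b (pl ℓ) (loc (pl ℓ) x) (loc (pl ℓ) y) ≠ 0)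
    (hline : ∀ (ℓ : ι) (s : Bool), ∃ e : Hv (pl ℓ), ∀ x ∈ E s, loc (pl ℓ) x ∈ Fv ℓ →
      ∃ a : F, loc (pl ℓ) x = a • e)
    (hrec : ∀ (x y : H) (T : Finset P), (∀ v, v ∉ T → b v (loc v x) (loc v y) = 0) →
      ∑ v ∈ T, b v (loc v x) (loc v y) = 0)
    (hcE : ∀ n, Good n → n.Nonempty → ∀ m : Finset ι, κ m n ∈ E (ε₀ n ^^ Nat.bodd m.card))
    (hcL : ∀ n, Good n → n.Nonempty → ∀ (m : Finset ι) (v : P), (∀ ℓ ∈ m, pl ℓ ≠ v) → loc v (κ m n) ∈ L n v)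
    (hcT : ∀ n, Good n → n.Nonempty → ∀ (m : Finset ι), ∀ ℓ ∈ m, loc (pl ℓ) (κ m n) ∈ Tv ℓ)
    (hfs : ∀ n, Good n → n.Nonempty → ∀ (m : Finset ι) (ℓ : ι), ℓ ∉ m →
      (loc (pl ℓ) (κ (insert ℓ m) n) = 0 ↔ loc (pl ℓ) (κ m n) = 0))
    (hCheb1 : ∀ x : H, x ≠ 0 → ∀ S : Finset ι, ∃ ℓ, ℓ ∉ S ∧ loc (pl ℓ) x ≠ 0)
    (hCheb2 : ∀ (s : Bool), ∀ x ∈ E s, ∀ y ∈ E (!s), x ≠ 0 → y ≠ 0 → ∀ S : Finset ι,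
      ∃ ℓ, ℓ ∉ S ∧ loc (pl ℓ) x ≠ 0 ∧ loc (pl ℓ) y ≠ 0)
    (hSupply : ∀ n, Good n → n.Nonempty → ∀ (ℓ : ι) (S : Finset ι), ℓ ∉ S → ∀ s : Bool, ∃ x ∈ E s, x ≠ 0 ∧
      (∀ v : P, v ≠ pl ℓ → (∀ ℓ' ∈ S, pl ℓ' ≠ v) → loc v x ∈ L n v) ∧ ∀ ℓ' ∈ S, loc (pl ℓ') x ∈ Tv ℓ')
    (hA1 : ∀ (n : Finset Q) (μ : Bool) (c : H), Good n → c ∈ Sel n μ → c ≠ 0 →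
      ∃ q, q ∉ n ∧ Good (insert q n) ∧ c ∉ Sel (insert q n) μ ∧ Sel (insert q n) μ ≤ Sel n μ ∧
        finrank F (Sel (insert q n) μ) + 1 = finrank F (Sel n μ) ∧ Sel (insert q n) (!μ) = Sel n (!μ))
    (hA2 : ∀ (n : Finset Q) (q₁ q₂ : Q), Good n → Good (insert q₁ n) → Good (insert q₂ (insert q₁ n)) →
      q₁ ∉ n → q₂ ∉ insert q₁ n → q₂ ∉ B (insert q₂ (insert q₁ n)) → ∃ m, κ m n ≠ 0)
    (hA4 : ∀ (n : Finset Q) (q : Q) (S : Set Q) (s : Bool), Good n → Good (insert q n) → q ∉ n → q ∈ S →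
      Sel n s ≤ SelRel (insert q n) S s)
    (hA5 : ∀ (n : Finset Q), Good n → n.Nonempty → Even n.card →
      finrank F (Sel n true) + finrank F (Sel n false) = 1 → κ m₁ n ≠ 0) :
    ∀ (n : Finset Q), Good n → Even n.card → Odd (finrank F (Sel n true) + finrank F (Sel n false)) →
      (n.Nonempty ∨ finrank F (Sel n true) + finrank F (Sel n false) ≠ 1) → ∃ m, κ m n ≠ 0 := by
  refine ZhangInductionOnPos.exists_ne_zero_of_zhangInduction_on_pos_oddStart Good Sel SelRel B κ m₁ hA1 hA2
    (fun n hg hn _ hne ↦ ?_) hA4 hA5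
  have hB' : ∀ v ∈ plQ '' B n, ∀ m : Finset ι, loc v (κ m n) = 0 := by
    rintro v ⟨q, hq, rfl⟩ m
    exact hB n q hq m
  exact triangulation_finite E loc b (L n) pl Fv Tv (fun m ↦ κ m n) (ε₀ n) (plQ '' B n) (Sel n) (SelRel n (B n))
    (hSel n hg) (hSelRel n hg) hB' hpl (hLF n) (hisoL n) hisoT hperf hline hrec (hcE n hg hn) (hcL n hg hn)
    (hcT n hg hn) (hfs n hg hn) hCheb1 hCheb2 (hSupply n hg hn) hne

end Summit.BirchSwinnertonDyer.Rank1Residual.X11b.Three.Koly.ZhangTriangulation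

/-! ## §3 A non-zero bottom class of a level system is a crux witness -/

namespace Summit.BirchSwinnertonDyer.Rank1Residual.X11b.Three.Koly.Method2

open WeierstrassCurve NumberField IsDedekindDomain
  Literature.NumberTheory.EllipticCurves Literature.NumberTheory.EllipticCurves.ModularForms
  Literature.NumberTheory.GaloisRepresentations Module

/-- **A square-free product of Kolyvagin primes**: for a finite set `m` of primes all satisfying `Kol`, the product
`∏ m` is `KolSupp Kol` (square-free with every prime factor in `Kol`). [cite: GrossLMS1991, §3 (n square-free, every
ℓ ∣ n satisfies (3.1)–(3.2))] -/
theorem kolSupp_finsetProd {Kol : ℕ → Prop} (hprime : ∀ ℓ, Kol ℓ → ℓ.Prime) (m : Finset {ℓ // Kol ℓ}) :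
    KolyvaginDescent.KolSupp Kol (∏ ℓ ∈ m, (ℓ : ℕ)) := by
  induction m using Finset.induction_on with
  | empty => simpa using KolyvaginDescent.kolSupp_one Kol
  | insert ℓ m hℓ ih =>
    rw [Finset.prod_insert hℓ]
    have hℓp : (ℓ : ℕ).Prime := hprime ℓ ℓ.2
    have hcop : Nat.Coprime (ℓ : ℕ) (∏ x ∈ m, (x : ℕ)) := by
      refine Nat.Coprime.prod_right fun x hx ↦ (Nat.coprime_primes hℓp (hprime x x.2)).mpr fun h ↦ hℓ ?_
      rwa [show ℓ = x from Subtype.ext h]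
    refine ⟨Nat.squarefree_mul_iff.mpr ⟨hcop, hℓp.squarefree, ih.1⟩, fun q hq ↦ ?_⟩
    have hne : (∏ x ∈ m, (x : ℕ)) ≠ 0 := Finset.prod_ne_zero_iff.mpr fun x _ ↦ (hprime x x.2).ne_zero
    rw [Nat.primeFactors_mul hℓp.ne_zero hne, Finset.mem_union, hℓp.primeFactors, Finset.mem_singleton] at hq
    rcases hq with rfl | hq
    · exact ℓ.2
    · exact ih.2 q hq

variable (W : WeierstrassCurve ℚ) (K : Type) [Field K] [NumberField K]
variable [W.IsElliptic] [W.IsGloballyMinimal] [NeZero (W.conductorNorm ℤ)]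
  (Dt : ModularParametrizationData W (W.conductorNorm ℤ)) (β : ℤ) (ι : K →+* ℂ) (c : K ≃ₐ[ℚ] K)
  [Module (ZMod 3) (V3 W K)]

omit [W.IsElliptic] in
/-- **A non-zero BOTTOM class of a level Kolyvagin system is a witness of the crux's conclusion at the frame**: by
`realisation`, `κ m ∅` is the Kolyvagin class mod 3 of some Kolyvagin–Heegner datum of conductor `∏ m`, which is a
square-free product of Kolyvagin primes (`kolSupp_finsetProd`). [cite: WZhang2014, §3.7 (3.21), §9] -/
theorem LevelKolyvaginSystem.exists_kolyvaginClass_ne_zero (S : LevelKolyvaginSystem W K Dt β ι c)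
    {m : Finset {ℓ // Zhang2014.IsKolyvaginPrime (W.conductorNorm ℤ) W K 3 ℓ}} (hm : S.κ m ∅ ≠ 0) :
    ∃ (n : ℕ) (d : KolyvaginHeegnerData Dt β ι n),
      KolyvaginDescent.KolSupp (Zhang2014.IsKolyvaginPrime (W.conductorNorm ℤ) W K 3) n ∧
        d.kolyvaginClass Nat.prime_three 1 ≠ 0 := by
  obtain ⟨d, hd⟩ := S.realisation m
  exact ⟨_, d, kolSupp_finsetProd (fun ℓ h ↦ h.1) m, hd ▸ hm⟩

/-! ## §4 S2-ENGINE modulo the engine's level-independent inputs -/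

/-- **The proposed stub S2-ENGINE, MODULO the engine-currency inputs.** At a frame: a `LevelKolyvaginSystem S`, stub
A's (A1) rank lowering on good levels for the canonical spaces `SelQ`, `dim_𝔽₃ Sel₃(E/K)` odd and `≥ 3` (`K` imaginary
quadratic), and — over ANY place-indexed apparatus `(P, Hv, loc, b, E, L, pl, plQ, Fv, Tv)` — the ENGINE-CURRENCY
readings: membership dictionaries for `SelQ` ∕ `SelRelQ n (baseLocusQ κ n)`, vanishing of the classes on `baseLocusQ`,
the Kolyvagin-system readings of `S.κ` at non-empty good levels (signs `S.ε₀`), and (REC), (Cheb) ×2, (Supply), (Perf)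
∕ (Line) ∕ (Iso), `hpl`, `hLF` ⟹ some Kolyvagin class of the frame is non-zero. Proof: §2 with `Good := GoodLevel`,
`Sel := SelQ`, `SelRel := SelRelQ`, `B := baseLocusQ S.κ`, `m₁ := ∅`, (A2) := `S.transport`, (A5) := `S.baseCase`,
(A4) := `relaxation_le`, started at `∅` (good, even, odd rank by `finrank_selmer_eq_finrank_selQ_add`, rank `≠ 1` by
`3 ≤ dim`); then §3. What remains for S2-ENGINE proper: discharge the engine-currency binders in the model
(memo S2-RELINE-19574 §2). [cite: WZhang2014, §9 proof of Thm. 9.1, Lemma 8.4, §8.1] -/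
theorem inductionOfLevelSystems_of_engineInputs (hK : IsImaginaryQuadratic K) (S : LevelKolyvaginSystem W K Dt β ι c)
    {P : Type} [DecidableEq P] {Hv : P → Type} [∀ v, AddCommGroup (Hv v)] [∀ v, Module (ZMod 3) (Hv v)]
    (E : Bool → Submodule (ZMod 3) (V3 W K)) (loc : (v : P) → V3 W K →ₗ[ZMod 3] Hv v)
    (b : (v : P) → Hv v →ₗ[ZMod 3] Hv v →ₗ[ZMod 3] ZMod 3)
    (L : Finset {q // IsUAdmissiblePrime W K q} → (v : P) → Submodule (ZMod 3) (Hv v))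
    (pl : {ℓ // Zhang2014.IsKolyvaginPrime (W.conductorNorm ℤ) W K 3 ℓ} → P)
    (plQ : {q // IsUAdmissiblePrime W K q} → P)
    (Fv Tv : (ℓ : {ℓ // Zhang2014.IsKolyvaginPrime (W.conductorNorm ℤ) W K 3 ℓ}) → Submodule (ZMod 3) (Hv (pl ℓ)))
    -- membership dictionaries and base-locus vanishing, engine currency
    (hSel : ∀ n, GoodLevel W K n → ∀ (s : Bool) (x : V3 W K), x ∈ SelQ W K c n s ↔ x ∈ E s ∧ ∀ v, loc v x ∈ L n v)
    (hSelRel : ∀ n, GoodLevel W K n → ∀ (s : Bool) (x : V3 W K),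
      x ∈ SelRelQ W K c n (baseLocusQ W K S.κ n) s ↔ x ∈ E s ∧ ∀ v, v ∉ plQ '' baseLocusQ W K S.κ n → loc v x ∈ L n v)
    (hB : ∀ n, ∀ q ∈ baseLocusQ W K S.κ n, ∀ m, loc (plQ q) (S.κ m n) = 0)
    -- the local picture at Kolyvagin primes and global reciprocity
    (hpl : Function.Injective pl)
    (hLF : ∀ n ℓ, L n (pl ℓ) = Fv ℓ)
    (hisoL : ∀ n (v : P), ∀ x ∈ L n v, ∀ y ∈ L n v, b v x y = 0)
    (hisoT : ∀ ℓ, ∀ x ∈ Tv ℓ, ∀ y ∈ Tv ℓ, b (pl ℓ) x y = 0)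
    (hperf : ∀ ℓ (s : Bool), ∀ x ∈ E s, ∀ y ∈ E s, loc (pl ℓ) x ∈ Fv ℓ → loc (pl ℓ) x ≠ 0 →
      loc (pl ℓ) y ∈ Tv ℓ → loc (pl ℓ) y ≠ 0 → b (pl ℓ) (loc (pl ℓ) x) (loc (pl ℓ) y) ≠ 0)
    (hline : ∀ ℓ (s : Bool), ∃ e : Hv (pl ℓ), ∀ x ∈ E s, loc (pl ℓ) x ∈ Fv ℓ → ∃ a : ZMod 3, loc (pl ℓ) x = a • e)
    (hrec : ∀ (x y : V3 W K) (T : Finset P), (∀ v, v ∉ T → b v (loc v x) (loc v y) = 0) →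
      ∑ v ∈ T, b v (loc v x) (loc v y) = 0)
    -- Kolyvagin-system readings of the system's classes at non-empty good levels
    (hcE : ∀ n, GoodLevel W K n → n.Nonempty → ∀ m, S.κ m n ∈ E (S.ε₀ n ^^ Nat.bodd m.card))
    (hcL : ∀ n, GoodLevel W K n → n.Nonempty → ∀ m (v : P), (∀ ℓ ∈ m, pl ℓ ≠ v) → loc v (S.κ m n) ∈ L n v)
    (hcT : ∀ n, GoodLevel W K n → n.Nonempty → ∀ m, ∀ ℓ ∈ m, loc (pl ℓ) (S.κ m n) ∈ Tv ℓ)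
    (hfs : ∀ n, GoodLevel W K n → n.Nonempty → ∀ m ℓ, ℓ ∉ m →
      (loc (pl ℓ) (S.κ (insert ℓ m) n) = 0 ↔ loc (pl ℓ) (S.κ m n) = 0))
    -- Čebotarev ×2 and Supply
    (hCheb1 : ∀ x : V3 W K, x ≠ 0 → ∀ T : Finset {ℓ // Zhang2014.IsKolyvaginPrime (W.conductorNorm ℤ) W K 3 ℓ},
      ∃ ℓ, ℓ ∉ T ∧ loc (pl ℓ) x ≠ 0)
    (hCheb2 : ∀ (s : Bool), ∀ x ∈ E s, ∀ y ∈ E (!s), x ≠ 0 → y ≠ 0 →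
      ∀ T : Finset {ℓ // Zhang2014.IsKolyvaginPrime (W.conductorNorm ℤ) W K 3 ℓ},
      ∃ ℓ, ℓ ∉ T ∧ loc (pl ℓ) x ≠ 0 ∧ loc (pl ℓ) y ≠ 0)
    (hSupply : ∀ n, GoodLevel W K n → n.Nonempty →
      ∀ (ℓ : {ℓ // Zhang2014.IsKolyvaginPrime (W.conductorNorm ℤ) W K 3 ℓ}) (T : Finset _), ℓ ∉ T →
      ∀ s : Bool, ∃ x ∈ E s, x ≠ 0 ∧
        (∀ v : P, v ≠ pl ℓ → (∀ ℓ' ∈ T, pl ℓ' ≠ v) → loc v x ∈ L n v) ∧ ∀ ℓ' ∈ T, loc (pl ℓ') x ∈ Tv ℓ')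
    -- (A1) at the frame (stub A's body), the parity and the rank ≥ 3
    (hA1 : ∀ (n : Finset {q // IsUAdmissiblePrime W K q}) (μ : Bool) (x : V3 W K),
      GoodLevel W K n → x ∈ SelQ W K c n μ → x ≠ 0 →
      ∃ q : {q // IsUAdmissiblePrime W K q}, q ∉ n ∧ GoodLevel W K (insert q n) ∧
        x ∉ SelQ W K c (insert q n) μ ∧
        SelQ W K c (insert q n) μ ≤ SelQ W K c n μ ∧
        finrank (ZMod 3) (SelQ W K c (insert q n) μ) + 1 = finrank (ZMod 3) (SelQ W K c n μ) ∧
        SelQ W K c (insert q n) (!μ) = SelQ W K c n (!μ))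
    (hodd : Odd (finrank (ZMod 3)
      (AddSubgroup.toZModSubmodule 3 (selmerGroup (W.baseChange K) ((3 ^ 1 : ℕ) : ℤ)))))
    (h3 : 3 ≤ finrank (ZMod 3)
      (AddSubgroup.toZModSubmodule 3 (selmerGroup (W.baseChange K) ((3 ^ 1 : ℕ) : ℤ)))) :
    ∃ (n : ℕ) (d : KolyvaginHeegnerData Dt β ι n),
      KolyvaginDescent.KolSupp (Zhang2014.IsKolyvaginPrime (W.conductorNorm ℤ) W K 3) n ∧
        d.kolyvaginClass Nat.prime_three 1 ≠ 0 := by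
  -- the parity and the rank at the bottom level, in canonical-space currency
  have hcc : c * c = 1 := algEquiv_mul_self_eq_one K hK c
  rw [finrank_selmer_eq_finrank_selQ_add W K hK c hcc] at hodd h3
  have hA4 : ∀ (n : Finset {q // IsUAdmissiblePrime W K q}) (q : {q // IsUAdmissiblePrime W K q})
      (T : Set {q // IsUAdmissiblePrime W K q}) (s : Bool), GoodLevel W K n → GoodLevel W K (insert q n) →
      q ∉ n → q ∈ T → SelQ W K c n s ≤ SelRelQ W K c (insert q n) T s :=
    fun n q T s _ _ hqn hqT ↦ relaxation_le W K c n q T s hqn hqT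
  obtain ⟨m, hm⟩ :=
    ZhangTriangulation.exists_ne_zero_of_zhangInduction_on_of_kolyvaginSystem_finite_oddStart (GoodLevel W K)
      (SelQ W K c) (SelRelQ W K c) (baseLocusQ W K S.κ) S.κ ∅ E loc b L pl plQ Fv Tv S.ε₀ hSel hSelRel hB hpl hLF
      hisoL hisoT hperf hline hrec hcE hcL hcT hfs hCheb1 hCheb2 hSupply hA1 S.transport hA4 S.baseCase ∅
      (goodLevel_empty W K) (by simp) hodd (Or.inr (by omega))
  exact S.exists_kolyvaginClass_ne_zero W K Dt β ι c hm

end Summit.BirchSwinnertonDyer.Rank1Residual.X11b.Three.Koly.Method2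

end
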